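import Summits.CriticalPhenomena.PercolationContinuityZ3.Theorems.PercNearOneGluingNoHeavyQuantGluedTwoGates
import Summits.CriticalPhenomena.PercolationContinuityZ3.Theorems.PercNearOneGluingNoHeavyQuantDepthOneTripleForests
import HarnessLib

/-!
# QUANT lane R8, T-DEC: the glued pair with two gates at its average floor ON THE NODE'S BINDER — two glued sibling records of one shape with
# gates `q₁, q₂`, at every floor `x ≤ (q₁+q₂)g/2` (prim-quant-census-2 gen 80)

builds on p205010 (kernel theorem, internal audit signed; external expert review pending)

Support file (`--supports stmt-CriticalPhenomena-4575`), QUANT lane census seat prim-quant-census-2 (gen 80); memo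
`run/shared/lean/prim/quant/prim-quant-census-2-g80/TRIPLE-G80.md` §6.  Theorems only, standard axioms, no sorries, no definitions.

* **`flaw_two_eq`** — `flaw [s₂, s₁] = gate ρ₁ q₁ ∗ gate ρ₂ q₂`, `ftop [s₂, s₁] = M₁ + M₂` (for `ρ₁` vanishing above `M₁`).
* **`sdec_gluedTwo_gates_le`** — `SDEC x (2(r+k)) (gate_{q₁} ρ ∗ gate_{q₂} ρ)` for every `0 < x ≤ (q₁+q₂)/2·g` (`sdec_mono` on `sdec_gluedTwo_gates`).
* **`sdec_flaw_two_gates`** — for sibling records `s₁, s₂` with `sᵢ.ρ = blobLaw [(k,g),(r,1)]`, `sᵢ.M = r+k`, `0 < sᵢ.q < 1`, `0 < g < 1` and every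
  `0 < x ≤ (s₁.q + s₂.q)/2·g`: `SDEC x (ftop [s₂, s₁]) (flaw [s₂, s₁])` — above the floor `min(q₁,q₂)·g` of `sdec_gluedTwo` (g79); the sibling
  with the smaller gate is NOT affordable at such `x` on its own, so the extension lemmas `sdec_append_*` do not apply to it as a one-record core.

HONEST STATUS.  Families, not the node; one shape for both records; `SiblingStep`, `FarTreeRow` OPEN; RATE class (log\*) / honest sentence of
`run/shared/lean/prim/quant/README.md` unchanged.  [this work].  Nothing here is cited as a published result.  The gluing rows served
[cite: KozmaNitzan2024, Conjecture 3 (p. 15)]; product measure [cite: Grimmett1999, §1.3 p. 10].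
-/

noncomputable section

open scoped BigOperators

namespace Summit.CriticalPhenomena.PercolationContinuityZ3.Theorems
namespace Quant
namespace LawDec

open Finset

/-- forest law of two records: `flaw [s₂, s₁] = gate ρ₁ q₁ ∗ gate ρ₂ q₂` and `ftop [s₂, s₁] = M₁ + M₂` (for `ρ₁` vanishing above `M₁`).
[this work] -/
theorem flaw_two_eq (s₁ s₂ : Sib) (h₁M : ∀ h, s₁.M < h → s₁.ρ h = 0) :
    flaw [s₂, s₁] = lconv s₁.M s₂.M (gate s₁.ρ s₁.q) (gate s₂.ρ s₂.q) ∧ ftop [s₂, s₁] = s₁.M + s₂.M := by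
  have e₁ : flaw [s₁] = gate s₁.ρ s₁.q := by
    funext h
    show lconv 0 s₁.M (fun i => if i = 0 then (1 : ℝ) else 0) (gate s₁.ρ s₁.q) h = gate s₁.ρ s₁.q h
    refine lconv_delta_left 0 s₁.M _ (fun k hk => ?_) h
    rw [gate_apply, h₁M k hk, if_neg (by omega)]
    ring
  refine ⟨?_, by simp [ftop]⟩
  show lconv (ftop [s₁]) s₂.M (flaw [s₁]) (gate s₂.ρ s₂.q) = _
  rw [e₁]; simp [ftop]

/-- **the glued pair with two gates at every floor `0 < x ≤ (q₁+q₂)/2·g`.** [this work] -/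
theorem sdec_gluedTwo_gates_le (r k : ℕ) {q₁ q₂ g x : ℝ} (hq₁0 : 0 < q₁) (hq₁1 : q₁ < 1) (hq₂0 : 0 < q₂) (hq₂1 : q₂ < 1)
    (hg0 : 0 < g) (hg1 : g < 1) (hx0 : 0 < x) (hx : x ≤ (q₁ + q₂) / 2 * g) :
    SDEC x ((r + k) + (r + k))
      (lconv (r + k) (r + k) (gate (blobLaw [(k, g), (r, 1)]) q₁) (gate (blobLaw [(k, g), (r, 1)]) q₂)) := by
  have _ := hx0
  exact sdec_mono (sdec_gluedTwo_gates r k hq₁0 hq₁1 hq₂0 hq₂1 hg0 hg1) hx (by nlinarith)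

/-- **TWO GLUED SIBLING RECORDS OF ONE SHAPE WITH TWO GATES ON THE BINDER, AVERAGE FLOOR**: `sᵢ.ρ = blobLaw [(k,g),(r,1)]`, `sᵢ.M = r + k`,
`0 < sᵢ.q < 1`, `0 < g < 1`, `0 < x ≤ (s₁.q + s₂.q)/2·g` ⟹ `SDEC x (ftop [s₂, s₁]) (flaw [s₂, s₁])`. [this work] -/
theorem sdec_flaw_two_gates {x : ℝ} (hx0 : 0 < x) (s₁ s₂ : Sib) (r k : ℕ) {g : ℝ} (hρ₁ : s₁.ρ = blobLaw [(k, g), (r, 1)])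
    (hρ₂ : s₂.ρ = blobLaw [(k, g), (r, 1)]) (hM₁ : s₁.M = r + k) (hM₂ : s₂.M = r + k) (hq₁0 : 0 < s₁.q) (hq₁1 : s₁.q < 1)
    (hq₂0 : 0 < s₂.q) (hq₂1 : s₂.q < 1) (hg0 : 0 < g) (hg1 : g < 1) (hx : x ≤ (s₁.q + s₂.q) / 2 * g) :
    SDEC x (ftop [s₂, s₁]) (flaw [s₂, s₁]) := by
  obtain ⟨_, aM, _, _⟩ := glued_blob_laws r k hg0.le hg1.le
  have ρM : ∀ h, s₁.M < h → s₁.ρ h = 0 := fun h hh => by rw [hρ₁]; exact aM h (by rw [← hM₁]; exact hh)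
  obtain ⟨eF, eT⟩ := flaw_two_eq s₁ s₂ ρM
  rw [eF, eT, hρ₁, hρ₂, hM₁, hM₂]
  exact sdec_gluedTwo_gates_le r k hq₁0 hq₁1 hq₂0 hq₂1 hg0 hg1 hx0 hx

end LawDec
end Quant
end Summit.CriticalPhenomena.PercolationContinuityZ3.Theorems
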